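import Literature.AlgebraicGeometry.Resolution.StrictNormalCrossingsLocalDescent
import Literature.AlgebraicGeometry.Resolution.StrictNormalCrossingsPoints
import Literature.AlgebraicGeometry.Limits.IdealSheafComap
import Literature.AlgebraicGeometry.Motives.SubschemeCyclesRatStalkProofs
import Mathlib.AlgebraicGeometry.Morphisms.Flat
import HarnessLib

/-!
# Strict normal crossings descend along faithfully flat affine morphisms

Topic: `Literature/AlgebraicGeometry/Resolution`. Scheme-level form of the descent of a strict
normal crossings divisor (de Jong 1996, 2.4; Stacks 0BI9, local form
`IsStrictNormalCrossingsDivisor`) through a base change `π : X̄ = X ⊗_{k₁} K → X` along an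
algebraic field extension — the step "`X̄₁, …` exist over `k₁`" of de Jong 1996, 4.5 for the
boundary divisor, once `k₁` is large enough that the divisor and its irreducible components are
defined over `k₁`:

**Theorem** (`IsStrictNormalCrossingsDivisor.of_preimage`). Let `π : X̄ → X` be affine, flat and
surjective with `X`, `X̄` locally Noetherian, `B ⊆ X` closed with `π⁻¹ B` a strict normal
crossings divisor in `X̄`. Assume the reduced structures descend: `I(π⁻¹B) = I(B) 𝒪_X̄`
(`vanishingIdeal (π⁻¹B) = (vanishingIdeal B).comap π`), and likewise for the closure of every
maximal point of `π⁻¹ B` (its irreducible components): `I(D̄) = 𝒥 𝒪_X̄` for some ideal sheaf `𝒥`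
on `X`. Then `B` is a strict normal crossings divisor in `X`.

At `p ∈ B` pick `p̄ ↦ p`; `𝒪_{X,p} → 𝒪_{X̄,p̄}` is flat local, `I(B)_p 𝒪_{X̄,p̄} = I(π⁻¹B)_{p̄} =
(x̄₁ ⋯ x̄_r)` for a regular system of parameters `x̄, ȳ` at `p̄`, and each branch `(x̄ᵢ)` — a
minimal prime of `I(π⁻¹B)_{p̄}`, i.e. the germ `I(D̄)_{p̄}` of an irreducible component `D̄` of
`π⁻¹ B` through `p̄` (`exists_isMax_of_mem_minimalPrimes`, `stalkIdeal_vanishingIdeal_closure`)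
— is extended from `𝒪_{X,p}`; so the local algebra `exists_rsop_prod_of_flat` applies.

## Content

* `stalkIdeal_comap` — `I.comap π` has stalk `I_{π p̄} · 𝒪_{X̄,p̄}` (affine `π`; from the chart
  formula `Literature.AlgebraicGeometry.Limits.ideal_comap_preimage`);
* `stalkIdeal_vanishingIdeal_closure` — for `η ⤳ p`, `I(cl{η})_p = (𝒪_{X,p} → 𝒪_{X,η})⁻¹ 𝔪_η`;
* `exists_isMax_of_mem_minimalPrimes` — minimal primes of `I(Z)_p` are the
  `(𝒪_{X,p} → 𝒪_{X,η})⁻¹ 𝔪_η` for maximal points `η` of `Z` specialising to `p` (Stacks 01J7);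
* `span_singleton_mem_minimalPrimes_of_rsop` — each `(x̄ᵢ)` is a minimal prime of `(∏ x̄ᵢ)`;
* `IsStrictNormalCrossingsDivisor.of_preimage`.

## References

* A. J. de Jong, *Smoothness, semi-stability and alterations*, Publ. Math. IHÉS 83 (1996), 2.4,
  4.5. [DeJong1996]
* The Stacks Project, Tags 0BI9 (strict normal crossings), 01J7 (points of `Spec 𝒪_{X,x}`).
* H. Matsumura, *Commutative Ring Theory* (1986), Thm. 14.2, 23.7. [Matsumura1987]
-/

noncomputable section

universe u

open CategoryTheory CategoryTheory.Limits AlgebraicGeometry TopologicalSpace IsLocalRing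
  Scheme.IdealSheafData

namespace Literature.AlgebraicGeometry.Resolution

set_option backward.isDefEq.respectTransparency false

/-! ## Stalks of pulled-back ideal sheaves -/

section Stalk

variable {X Y : Scheme.{u}}

/-- **The stalk of a pulled-back ideal sheaf** along an affine morphism `π : X → Y`:
`(𝒥.comap π)_x = 𝒥_{π x} · 𝒪_{X,x}` (chart formula `ideal_comap_preimage` and
`germ ∘ π^* = π^*_x ∘ germ`). [folklore] -/
theorem stalkIdeal_comap (π : X ⟶ Y) [IsAffineHom π] (𝒥 : Y.IdealSheafData) (x : X) :
    stalkIdeal (𝒥.comap π) x = (stalkIdeal 𝒥 (π x)).map (π.stalkMap x).hom := by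
  obtain ⟨_, ⟨U, hU, rfl⟩, hxU, -⟩ :=
    Y.isBasis_affineOpens.exists_subset_of_mem_open (Set.mem_univ (π x)) isOpen_univ
  have hV : IsAffineOpen (π ⁻¹ᵁ U) := hU.preimage π
  have hxV : x ∈ π ⁻¹ᵁ U := hxU
  rw [stalkIdeal_eq_map_germ (𝒥.comap π) ⟨π ⁻¹ᵁ U, hV⟩ hxV, stalkIdeal_eq_map_germ 𝒥 ⟨U, hU⟩ hxU,
    Literature.AlgebraicGeometry.Limits.ideal_comap_preimage π 𝒥 ⟨U, hU⟩ hV, Ideal.map_map,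
    Ideal.map_map]
  congr 1
  rw [← CommRingCat.hom_comp, ← CommRingCat.hom_comp, Scheme.Hom.germ_stalkMap π U x hxU]

end Stalk

/-! ## Generisations and germs of vanishing ideals -/

section Generization

variable {X : Scheme.{u}} {p : X}

/-- The prime `𝔭_η = (𝒪_{X,p} → 𝒪_{X,η})⁻¹ 𝔪_η` of a generisation `η ⤳ p`. [folklore] -/
abbrev primeOfSpecializes {η : X} (h : η ⤳ p) : Ideal (X.presheaf.stalk p) :=
  (maximalIdeal (X.presheaf.stalk η)).comap (X.presheaf.stalkSpecializes h).hom

/-- On an affine open `U ∋ p`, the contraction of `𝔭_η` to `Γ(X, U)` is the prime of `η`.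
[folklore] -/
theorem comap_germ_primeOfSpecializes {η : X} (h : η ⤳ p) (U : X.affineOpens)
    (hpU : p ∈ (U : X.Opens)) :
    (primeOfSpecializes h).comap (X.presheaf.germ U p hpU).hom =
      (U.2.primeIdealOf ⟨η, h.mem_open U.1.isOpen hpU⟩).asIdeal := by
  ext s
  rw [Ideal.mem_comap, Ideal.mem_comap,
    Literature.AlgebraicGeometry.Motives.mem_primeIdealOf_iff U.2 ⟨η, _⟩ s]
  change (X.presheaf.germ U p hpU ≫ X.presheaf.stalkSpecializes h).hom s ∈ _ ↔ _
  rw [TopCat.Presheaf.germ_stalkSpecializes]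

/-- `𝔭_η` is the extension of the prime of `η` in `Γ(X, U)` to the localisation `𝒪_{X,p}`.
[folklore] -/
theorem primeOfSpecializes_eq_map_germ {η : X} (h : η ⤳ p) (U : X.affineOpens)
    (hpU : p ∈ (U : X.Opens)) :
    primeOfSpecializes h =
      (U.2.primeIdealOf ⟨η, h.mem_open U.1.isOpen hpU⟩).asIdeal.map (X.presheaf.germ U p hpU).hom := by
  letI := TopCat.Presheaf.algebra_section_stalk X.presheaf (⟨p, hpU⟩ : (U : X.Opens))
  haveI := U.2.isLocalization_stalk ⟨p, hpU⟩
  rw [← comap_germ_primeOfSpecializes h U hpU]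
  exact (IsLocalization.map_under (M := (U.2.primeIdealOf ⟨p, hpU⟩).asIdeal.primeCompl)
    (S := X.presheaf.stalk p) (primeOfSpecializes h)).symm

/-- On an affine open `U ∋ η`, the vanishing ideal sheaf of `cl{η}` has `U`-component the prime
of `η`. [folklore] -/
theorem vanishingIdeal_closure_ideal {η : X} (U : X.affineOpens) (hηU : η ∈ (U : X.Opens)) :
    (vanishingIdeal ⟨closure {η}, isClosed_closure⟩).ideal U = (U.2.primeIdealOf ⟨η, hηU⟩).asIdeal := by
  rw [vanishingIdeal_ideal]
  change PrimeSpectrum.vanishingIdeal (U.2.fromSpec ⁻¹' closure {η}) = _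
  rw [U.2.fromSpec.isOpenEmbedding.isOpenMap.preimage_closure_eq_closure_preimage
    U.2.fromSpec.continuous, PrimeSpectrum.vanishingIdeal_closure]
  have : U.2.fromSpec ⁻¹' {η} = {U.2.primeIdealOf ⟨η, hηU⟩} := by
    ext q
    simp only [Set.mem_preimage, Set.mem_singleton_iff]
    constructor
    · intro hq
      apply U.2.fromSpec.isOpenEmbedding.injective
      rw [hq, IsAffineOpen.fromSpec_primeIdealOf]
    · rintro rfl
      exact U.2.fromSpec_primeIdealOf ⟨η, hηU⟩
  rw [this, PrimeSpectrum.vanishingIdeal_singleton]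

/-- **The germ at `p` of the vanishing ideal of `cl{η}`, for `η ⤳ p`, is `𝔭_η`.** [folklore] -/
theorem stalkIdeal_vanishingIdeal_closure {η : X} (h : η ⤳ p) :
    stalkIdeal (vanishingIdeal ⟨closure {η}, isClosed_closure⟩) p = primeOfSpecializes h := by
  obtain ⟨_, ⟨U, hU, rfl⟩, hpU, -⟩ :=
    X.isBasis_affineOpens.exists_subset_of_mem_open (Set.mem_univ p) isOpen_univ
  rw [stalkIdeal_eq_map_germ _ ⟨U, hU⟩ hpU, primeOfSpecializes_eq_map_germ h ⟨U, hU⟩ hpU,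
    vanishingIdeal_closure_ideal ⟨U, hU⟩ (h.mem_open U.isOpen hpU)]

/-- For `η ⤳ p` lying on a closed subset `Z`, `I(Z)_p ≤ 𝔭_η`. [folklore] -/
theorem stalkIdeal_vanishingIdeal_le {Z : Closeds X} {η : X} (h : η ⤳ p) (hη : η ∈ Z) :
    stalkIdeal (vanishingIdeal Z) p ≤ primeOfSpecializes h := by
  rw [← stalkIdeal_vanishingIdeal_closure h]
  apply stalkIdeal_mono
  apply vanishingIdeal_antimono
  change closure {η} ⊆ (Z : Set X)
  exact closure_minimal (Set.singleton_subset_iff.mpr hη) Z.isClosed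

/-- For `η' ⤳ η ⤳ p`, `𝔭_{η'} ≤ 𝔭_η`. [folklore] -/
theorem primeOfSpecializes_mono {η η' : X} (h : η ⤳ p) (h' : η' ⤳ η) :
    primeOfSpecializes (h'.trans h) ≤ primeOfSpecializes h := by
  intro s hs
  change (X.presheaf.stalkSpecializes h).hom s ∈ maximalIdeal _
  have hs' : (X.presheaf.stalkSpecializes (h'.trans h)).hom s ∈ maximalIdeal _ := hs
  rw [← TopCat.Presheaf.stalkSpecializes_comp X.presheaf h' h, CommRingCat.hom_comp,
    RingHom.comp_apply] at hs'
  by_contra hne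
  have hu : IsUnit ((X.presheaf.stalkSpecializes h).hom s) := (notMem_maximalIdeal).mp hne
  exact (notMem_maximalIdeal.mpr (hu.map _)) hs'

/-- **Minimal primes of the germ of a vanishing ideal are germs of components** (Stacks 01J7):
for a closed `Z ∋ p`, every minimal prime of `I(Z)_p ⊆ 𝒪_{X,p}` is `𝔭_η` for a point `η ∈ Z`
specialising to `p` and maximal in `Z` for the specialisation order (the generic point of an
irreducible component of `Z` through `p`). [cite: StacksProject, Tag 01J7] -/
theorem exists_isMax_of_mem_minimalPrimes {Z : Closeds X} {P : Ideal (X.presheaf.stalk p)}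
    (hP : P ∈ (stalkIdeal (vanishingIdeal Z) p).minimalPrimes) :
    ∃ (η : X) (h : η ⤳ p), η ∈ Z ∧ (∀ η' ∈ Z, η' ⤳ η → η' = η) ∧ P = primeOfSpecializes h := by
  haveI hPp : P.IsPrime := hP.1.1
  let pt : Spec (X.presheaf.stalk p) := ⟨P, hPp⟩
  let η : X := X.fromSpecStalk p pt
  have hη : η ⤳ p := by
    have : η ∈ Set.range (X.fromSpecStalk p) := ⟨pt, rfl⟩
    rwa [Scheme.range_fromSpecStalk] at this
  have hPη : P = primeOfSpecializes hη := by
    have key : X.fromSpecStalk p pt = X.fromSpecStalk p ⟨primeOfSpecializes hη, inferInstance⟩ := by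
      rw [Literature.AlgebraicGeometry.Motives.fromSpecStalk_comap_maximalIdeal hη]
    exact congrArg PrimeSpectrum.asIdeal ((X.fromSpecStalk p).isEmbedding.injective key)
  -- an affine chart around `p`
  obtain ⟨_, ⟨U, hU, rfl⟩, hpU, -⟩ :=
    X.isBasis_affineOpens.exists_subset_of_mem_open (Set.mem_univ p) isOpen_univ
  have hηU : η ∈ U := hη.mem_open U.isOpen hpU
  -- `η ∈ Z`
  have hηZ : η ∈ Z := by
    by_contra hηZ
    -- a function on `U` vanishing on `Z` but not at `η`
    have hq : hU.primeIdealOf ⟨η, hηU⟩ ∉ hU.fromSpec ⁻¹' (Z : Set X) := by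
      rw [Set.mem_preimage, IsAffineOpen.fromSpec_primeIdealOf]
      exact hηZ
    have hcl : IsClosed (hU.fromSpec ⁻¹' (Z : Set X)) := Z.isClosed.preimage hU.fromSpec.continuous
    rw [← hcl.closure_eq, ← PrimeSpectrum.zeroLocus_vanishingIdeal_eq_closure,
      PrimeSpectrum.mem_zeroLocus, Set.not_subset] at hq
    obtain ⟨f, hf, hfq⟩ := hq
    have h1 : (X.presheaf.germ U p hpU).hom f ∈ stalkIdeal (vanishingIdeal Z) p := by
      rw [stalkIdeal_eq_map_germ _ ⟨U, hU⟩ hpU]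
      exact Ideal.mem_map_of_mem _ (by rwa [vanishingIdeal_ideal])
    have h2 : (X.presheaf.germ U p hpU).hom f ∈ primeOfSpecializes hη := hPη ▸ hP.1.2 h1
    rw [← Ideal.mem_comap, comap_germ_primeOfSpecializes hη ⟨U, hU⟩ hpU] at h2
    exact hfq h2
  refine ⟨η, hη, hηZ, fun η' hη'Z hη'η => ?_, hPη⟩
  -- maximality
  have hle : primeOfSpecializes (hη'η.trans hη) ≤ P := hPη ▸ primeOfSpecializes_mono hη hη'η
  have hge : stalkIdeal (vanishingIdeal Z) p ≤ primeOfSpecializes (hη'η.trans hη) :=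
    stalkIdeal_vanishingIdeal_le _ hη'Z
  have heq : primeOfSpecializes (hη'η.trans hη) = P :=
    le_antisymm hle (hP.2 ⟨inferInstance, hge⟩ hle)
  rw [hPη] at heq
  exact Literature.AlgebraicGeometry.Motives.eq_of_comap_maximalIdeal_eq _ _ heq

end Generization

/-! ## Branches of a strict normal crossings divisor are minimal primes -/

section Branches

variable {R : Type u} [CommRing R] [IsRegularLocalRing R]

/-- For a regular system of parameters `x̄ : Fin r → R`, `ȳ : Fin e → R` of a regular local
ring, each branch ideal `(x̄ᵢ)` is a minimal prime of `(x̄₁ ⋯ x̄_r)` (the `x̄ᵢ` are pairwise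
non-associate primes, Matsumura Thm. 14.2/14.3). [cite: Matsumura1987, Thm. 14.2] -/
theorem span_singleton_mem_minimalPrimes_of_rsop {r e : ℕ} (xb : Fin r → R) (yb : Fin e → R)
    (hdim : ringKrullDim R = (r + e : ℕ))
    (hspan : Ideal.span (Set.range xb ∪ Set.range yb) = maximalIdeal R) (i : Fin r) :
    Ideal.span {xb i} ∈ (Ideal.span {∏ j, xb j}).minimalPrimes := by
  classical
  let z : Fin (r + e) → R := Fin.append xb yb
  have hz : Ideal.span (Set.range z) = maximalIdeal R := by
    have : Set.range z = Set.range xb ∪ Set.range yb := by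
      ext a
      simp only [z, Set.mem_range, Set.mem_union]
      constructor
      · rintro ⟨k, rfl⟩
        refine Fin.addCases (fun k => ?_) (fun k => ?_) k
        · exact Or.inl ⟨k, by rw [Fin.append_left]⟩
        · exact Or.inr ⟨k, by rw [Fin.append_right]⟩
      · rintro (⟨k, rfl⟩ | ⟨k, rfl⟩)
        · exact ⟨Fin.castAdd e k, by rw [Fin.append_left]⟩
        · exact ⟨Fin.natAdd r k, by rw [Fin.append_right]⟩
    rw [this, hspan]
  have hd : (maximalIdeal R).spanFinrank = r + e := by
    have h := IsRegularLocalRing.spanFinrank_maximalIdeal (R := R)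
    rw [hdim] at h
    exact_mod_cast h
  have hxz : ∀ j, xb j = z (Fin.castAdd e j) := fun j => (Fin.append_left xb yb j).symm
  -- `(x̄ᵢ)` is prime
  have hprime : (Ideal.span {xb i}).IsPrime := by
    have := isPrime_span_image hd z hz {Fin.castAdd e i}
    simpa [hxz] using this
  refine ⟨⟨hprime, ?_⟩, fun Q ⟨hQ, hQle⟩ hQi => ?_⟩
  · rw [Ideal.span_singleton_le_iff_mem]
    exact Ideal.mem_span_singleton.mpr (Finset.dvd_prod_of_mem _ (Finset.mem_univ i))
  · -- a prime between `(∏ x̄)` and `(x̄ᵢ)` contains some `x̄ⱼ`, necessarily `x̄ᵢ`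
    have hmem : ∏ j, xb j ∈ Q := hQle (Ideal.mem_span_singleton_self _)
    haveI := hQ
    obtain ⟨j, -, hj⟩ := Ideal.IsPrime.prod_mem_iff.mp hmem
    have hji : j = i := by
      by_contra hji
      have h1 : xb j ∈ Ideal.span {xb i} := hQi hj
      have h2 := not_mem_span_image_of_not_mem hd z hz (S := {Fin.castAdd e i})
        (i := Fin.castAdd e j) (by
          rw [Set.mem_singleton_iff]
          exact fun h => hji (Fin.castAdd_injective _ _ h))
      apply h2
      rwa [Set.image_singleton, ← hxz, ← hxz]
    subst hji
    exact (Ideal.span_singleton_le_iff_mem _).mpr hj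

end Branches

/-! ## The descent theorem -/

section Descent

variable {X Xb : Scheme.{u}}

/-- **Strict normal crossings descend along an affine, flat, surjective morphism once the
reduced structures of the divisor and of its components descend** (used for de Jong 1996, 4.5:
the boundary divisor over `k̄` is defined, with its components, over a finite extension `k₁`).
Let `π : X̄ → X` be affine, flat and surjective, `X` locally Noetherian, `B ⊆ X` closed with
`π⁻¹ B` a strict normal crossings divisor in `X̄` (local form, de Jong 2.4 / Stacks 0BI9).
Assume `I(π⁻¹ B) = I(B) · 𝒪_X̄` and that for every maximal point `η` of `π⁻¹ B` (generic point
of an irreducible component) `I(cl{η}) = 𝒥 · 𝒪_X̄` for some quasi-coherent ideal `𝒥` of `X`.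
Then `B` is a strict normal crossings divisor in `X`: at `p = π(p̄)`, `𝒪_{X,p} → 𝒪_{X̄,p̄}` is
flat local, `I(B)_p 𝒪_{X̄,p̄} = (x̄₁ ⋯ x̄_r)` and the branches `(x̄ᵢ) = I(cl{ηᵢ})_{p̄}` are extended
from `𝒪_{X,p}`, so `exists_rsop_prod_of_flat` applies. [cite: DeJong1996, 2.4 and 4.5, pp. 55, 66] -/
theorem IsStrictNormalCrossingsDivisor.of_preimage (π : Xb ⟶ X) [IsAffineHom π] [Flat π]
    [Surjective π] [IsLocallyNoetherian X] {B : Set X} (hB : IsClosed B)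
    (hsnc : IsStrictNormalCrossingsDivisor Xb (π ⁻¹' B))
    (H1 : vanishingIdeal ⟨π ⁻¹' B, hB.preimage π.continuous⟩ =
      (vanishingIdeal ⟨B, hB⟩).comap π)
    (H2 : ∀ η ∈ π ⁻¹' B, (∀ η' ∈ π ⁻¹' B, η' ⤳ η → η' = η) →
      ∃ 𝒥 : X.IdealSheafData, vanishingIdeal ⟨closure {η}, isClosed_closure⟩ = 𝒥.comap π) :
    IsStrictNormalCrossingsDivisor X B := by
  classical
  rw [isStrictNormalCrossingsDivisor_iff_stalkIdeal]
  refine ⟨hB, fun p hp => ?_⟩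
  obtain ⟨pb, rfl⟩ := π.surjective p
  have hpbB : pb ∈ π ⁻¹' B := hp
  have hBc : (⟨closure B, isClosed_closure⟩ : Closeds X) = ⟨B, hB⟩ :=
    Closeds.ext hB.closure_eq
  have hBbc : (⟨closure (π ⁻¹' B), isClosed_closure⟩ : Closeds Xb) =
      ⟨π ⁻¹' B, hB.preimage π.continuous⟩ :=
    Closeds.ext (hB.preimage π.continuous).closure_eq
  rw [hBc]
  -- the local data at `p̄`
  rw [isStrictNormalCrossingsDivisor_iff_stalkIdeal] at hsnc
  obtain ⟨hreg, r, e, xb, yb, hr, hdim, hspan, hIb⟩ := hsnc.2 pb hpbB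
  rw [hBbc] at hIb
  -- the flat local homomorphism `𝒪_{X,p} → 𝒪_{X̄,p̄}`
  let A := X.presheaf.stalk (π pb)
  let B' := Xb.presheaf.stalk pb
  let φ : A →+* B' := (π.stalkMap pb).hom
  letI : Algebra A B' := φ.toAlgebra
  haveI : Module.Flat A B' := Flat.stalkMap π pb
  haveI : IsLocalHom (algebraMap A B') := inferInstanceAs (IsLocalHom (π.stalkMap pb).hom)
  haveI : IsRegularLocalRing B' := hreg
  -- `I(B)_p B' = I(π⁻¹B)_{p̄} = (∏ x̄ᵢ)`
  let I : Ideal A := stalkIdeal (vanishingIdeal ⟨B, hB⟩) (π pb)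
  have hI : I.map (algebraMap A B') = Ideal.span {∏ i, xb i} := by
    rw [← hIb, H1, stalkIdeal_comap]
    rfl
  -- the branches are extended from `A`
  have hdesc : ∀ i, ((Ideal.span {xb i}).comap (algebraMap A B')).map (algebraMap A B') =
      Ideal.span {xb i} := by
    intro i
    have hmin : Ideal.span {xb i} ∈
        (stalkIdeal (vanishingIdeal ⟨π ⁻¹' B, hB.preimage π.continuous⟩) pb).minimalPrimes := by
      rw [hIb]
      exact span_singleton_mem_minimalPrimes_of_rsop xb yb hdim hspan i
    obtain ⟨η, hη, hηB, hmax, hPη⟩ := exists_isMax_of_mem_minimalPrimes hmin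
    obtain ⟨𝒥, h𝒥⟩ := H2 η hηB hmax
    have hQ : Ideal.span {xb i} = (stalkIdeal 𝒥 (π pb)).map (algebraMap A B') := by
      rw [hPη, ← stalkIdeal_vanishingIdeal_closure hη, h𝒥, stalkIdeal_comap]
      rfl
    apply le_antisymm Ideal.map_comap_le
    conv_lhs => rw [hQ]
    exact Ideal.map_mono (Ideal.le_comap_map.trans (Ideal.comap_mono hQ.ge))
  -- the local algebra
  obtain ⟨hA, e', x, y, hdimA, hspanA, hIx, -⟩ :=
    exists_rsop_prod_of_flat xb yb hdim hspan I hI hdesc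
  exact ⟨hA, r, e', x, y, hr, hdimA, hspanA, hIx⟩

end Descent

end Literature.AlgebraicGeometry.Resolution

end
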